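import Mathlib.Analysis.SpecialFunctions.Integrals.Basic
import Mathlib.Analysis.SpecialFunctions.Log.Monotone
import Mathlib.Analysis.Complex.ExponentialBounds
import Literature.NumberTheory.DiophantineApproximation.ContinuedFractionExpOne

/-!
# Davis's approximation measure of `e` — proof of `Davis1978_thm1`

This file DISCHARGES the named fact `Davis1978_thm1` (C. S. Davis, *Rational approximations
to e*, J. Austral. Math. Soc. A 25 (1978) 497–502, Theorem 1, p. 498) vendored in
`Literature/NumberTheory/DiophantineApproximation/ContinuedFractionExpOne.lean`:
`theorem Davis1978_thm1_holds : Davis1978_thm1`. It is a sibling module so that the fact file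
and its importers do not acquire the calculus imports; it contains theorems only (the partial
quotients, the convergents and Hermite's integrals are section variables constrained by
hypotheses `h`, `hM`, instantiated in the final theorem), and it does not use Euler's theorem
`EulerContFractExpOne`.

## The printed proof and how it is followed

Davis (pp. 499–501): Hermite-type integrals `Q_n = (1/n!) ∫₀¹ e^{-t} tⁿ (t−1)ⁿ dt`,
`S_n, U_n` (and `P_n, R_n, T_n`) satisfy `S_n = 2n Q_n + U_{n−1}`, `Q_n = U_{n−1} + S_{n−1}`,
`U_n = S_n + Q_n` (Lemmas 1–2), hence are the denominators (numerators) of the convergents of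
`e = [2; 1, 2, 1, 1, 4, 1, 1, 6, …]` (Lemmas 4–6, via Legendre's criterion); Lemma 3 (Tannery +
Stirling) gives `log Q_n ~ n log n`, so `|e − P_n/Q_n| ~ 1/(2n Q_n²) ~ ½ log log Q_n /(Q_n² log
Q_n)` — relation (3) — which is part (1); for part (2), a non-convergent has
`|e − p/q| > 1/(2q²)`, a convergent other than `P_n/Q_n` has next partial quotient `1` whence
`|e − p/q| > 1/(3q²)`, and `P_n/Q_n` itself is handled by (3).

Here (namespace `Davis1978`):

* `section Convergents`: sequences `a P Q : ℕ → ℕ` subject to the hypothesis `h` that `a m`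
  (`m ≥ 2`) are the partial quotients of `e = [1; 0, 1, 1, 2, 1, 1, 4, 1, 1, 6, …]` in Cohn's
  uniform indexing (`a_{3i+1} = 2i`, else `1`; H. Cohn, Amer. Math. Monthly 113 (2006) 57–62)
  and `P`, `Q` the convergents `p_m/q_m` (`p_0 = p_1 = 1`, `q_0 = 1`, `q_1 = 0`, the usual
  recurrence) — Davis's `Q_n` is `q_{3n}` up to the index shift; the errors `d_m = q_m e − p_m`
  are written out as `(Q m : ℝ) * exp 1 - P m`;
* `section Integrals`: `M j k = ∫₀¹ x^j (x−1)^k eˣ dx` (hypothesis `hM`) — Hermite's integrals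
  (`eˣ` on `[0,1]` instead of Davis's `e^{−t}`, as in Cohn); `H_rel`/`H_succ_sub` are Davis's
  Lemma 1 = Cohn's (4)–(6),
  proved by the fundamental theorem of calculus, and `H_eq_err` is Cohn's Theorem
  (`A_n = q_{3n}e − p_{3n}`, …) by induction; `H_sign`/`err_sign` give the alternating signs,
  `den_abs_err` the exact identity `q_{m+1}|d_m| + q_m|d_{m+1}| = 1`
  (so `1/(q_{m+1}+q_m) ≤ |d_m| ≤ 1/q_{m+1}`);
* growth (Davis's Lemma 3, in the crude form that suffices for `log Q_n ~ n log n`):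
  `(i+1)^i ≤ q_{3i+3} ≤ (8(i+1))^i` from `q_{3i+6} = (4i+5) q_{3i+3} + 2 q_{3i+2}`;
* DEVIATION from the printed road: instead of Legendre's criterion and the identification of
  *all* convergents of `GenContFract.of (exp 1)` (Davis's Lemmas 4–6, i.e. Euler's theorem, the
  separate fact `EulerContFractExpOne`), part (2) uses Lagrange's best-approximation
  lemma `lagrange_aux` (unimodularity + opposite signs ⇒ `|qe − p| ≥ |d_m|` for `q < q_{m+1}`)
  applied directly to the explicit sequence; this yields exactly Davis's case split (next partial
  quotient `1` versus `2i+2`) without continued-fraction uniqueness;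
* `upper_estimate`, `lower_threshold`, `lower_estimate` — the `log log q / log q` bookkeeping
  (antitonicity of `log y / y` on `[e, ∞)` from Mathlib), then `Davis1978_thm1_holds`, where the
  sequences are instantiated by an anonymous `Nat.rec`.

What is NOT here: Euler's continued fraction as a statement about `GenContFract.of (exp 1)`
(the fact `EulerContFractExpOne`, discharged separately in the sibling module
`ContinuedFractionExpOneProofs.lean`; this file neither imports nor needs it), Davis's
Theorem 2 (`e^{2/t}`), and the precise asymptotics of Lemma 3.
-/

noncomputable section

namespace Literature.NumberTheory.DiophantineApproximation

namespace Davis1978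

open Real intervalIntegral MeasureTheory Set Filter
open scoped Nat
open scoped _root_.Topology

/-! ### Hermite's integrals -/

/-- The integrand `x^j (x−1)^k e^x` is interval integrable. [cite: Cohn2006, §2] -/
theorem her_intervalIntegrable (j k : ℕ) (a b : ℝ) :
    IntervalIntegrable (fun x : ℝ => x ^ j * (x - 1) ^ k * exp x) volume a b := by
  apply Continuous.intervalIntegrable; fun_prop

section Integrals

variable {M : ℕ → ℕ → ℝ}

/- HYPOTHESIS of this section: `M j k` is Hermite's integral `∫₀¹ x^j (x−1)^k eˣ dx` (Cohn's
`A_n, B_n, C_n` are `M n n / n!`, `M (n+1) n / n!`, `M n (n+1) / n!`); instantiated (by `rfl`)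
where it is used. -/
variable (hM : ∀ j k : ℕ, M j k = ∫ x in (0:ℝ)..1, x ^ j * (x - 1) ^ k * exp x)
include hM

/-- `M(j+1,k) − M(j,k+1) = M(j,k)` (since `x − (x−1) = 1`). [cite: Cohn2006, §2, (6)] -/
theorem H_succ_sub (j k : ℕ) : M (j + 1) k - M j (k + 1) = M j k := by
  rw [hM, hM, hM, ← integral_sub (her_intervalIntegrable _ _ _ _) (her_intervalIntegrable _ _ _ _)]
  refine integral_congr fun x _ => ?_
  ring

/-- Integrating `d/dx (x^{j+1} (x−1)^{k+1} e^x)` over `[0,1]`: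
`(j+1) M(j,k+1) + (k+1) M(j+1,k) + M(j+1,k+1) = 0`. [cite: Cohn2006, §2, (4)–(5)] -/
theorem H_rel (j k : ℕ) :
    (j + 1) * M j (k + 1) + (k + 1) * M (j + 1) k + M (j + 1) (k + 1) = 0 := by
  have hderiv : ∀ x ∈ uIcc (0:ℝ) 1,
      HasDerivAt (fun y : ℝ => y ^ (j + 1) * (y - 1) ^ (k + 1) * exp y)
        ((j + 1) * (x ^ j * (x - 1) ^ (k + 1) * exp x) +
          (k + 1) * (x ^ (j + 1) * (x - 1) ^ k * exp x) +
          x ^ (j + 1) * (x - 1) ^ (k + 1) * exp x) x := by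
    intro x _
    have h1 : HasDerivAt (fun y : ℝ => y ^ (j + 1)) ((j + 1) * x ^ j) x := by
      simpa using hasDerivAt_pow (j + 1) x
    have h2 : HasDerivAt (fun y : ℝ => (y - 1) ^ (k + 1)) ((k + 1) * (x - 1) ^ k) x := by
      simpa using ((hasDerivAt_id x).sub_const 1).fun_pow (k + 1)
    have h3 := (h1.fun_mul h2).fun_mul (Real.hasDerivAt_exp x)
    refine h3.congr_deriv ?_
    ring
  have hint : IntervalIntegrable (fun x : ℝ => (j + 1) * (x ^ j * (x - 1) ^ (k + 1) * exp x) +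
      (k + 1) * (x ^ (j + 1) * (x - 1) ^ k * exp x) +
      x ^ (j + 1) * (x - 1) ^ (k + 1) * exp x) volume 0 1 := by
    apply Continuous.intervalIntegrable; fun_prop
  have hftc := integral_eq_sub_of_hasDerivAt hderiv hint
  rw [intervalIntegral.integral_add, intervalIntegral.integral_add,
    intervalIntegral.integral_const_mul, intervalIntegral.integral_const_mul] at hftc
  · rw [hM, hM, hM, hftc]; simp
  · exact ((her_intervalIntegrable _ _ _ _).const_mul _)
  · exact ((her_intervalIntegrable _ _ _ _).const_mul _)
  · exact ((her_intervalIntegrable _ _ _ _).const_mul _).add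
      ((her_intervalIntegrable _ _ _ _).const_mul _)
  · exact her_intervalIntegrable _ _ _ _

/-- `M(0,0) = e − 1`. [cite: Cohn2006, §2] -/
theorem H_zero_zero : M 0 0 = exp 1 - 1 := by
  rw [hM]; simp [integral_exp]

/-- `M(1,0) = ∫₀¹ x e^x dx = 1`. [cite: Cohn2006, §2] -/
theorem H_one_zero : M 1 0 = 1 := by
  have hderiv : ∀ x ∈ uIcc (0:ℝ) 1,
      HasDerivAt (fun y : ℝ => (y - 1) * exp y) (x ^ 1 * (x - 1) ^ 0 * exp x) x := by
    intro x _
    have := ((hasDerivAt_id x).sub_const 1).fun_mul (Real.hasDerivAt_exp x)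
    refine this.congr_deriv ?_
    simp; ring
  have := integral_eq_sub_of_hasDerivAt hderiv (her_intervalIntegrable 1 0 0 1)
  rw [hM, this]; simp

/-- The integrals have a definite sign: `(−1)^k M(j,k) > 0`. [cite: Cohn2006, §2] -/
theorem H_sign (j k : ℕ) : 0 < (-1) ^ k * M j k := by
  rw [hM, ← intervalIntegral.integral_const_mul]
  apply intervalIntegral_pos_of_pos_on
  · exact (her_intervalIntegrable j k _ _).const_mul _
  · intro x hx
    have h1 : 0 < x := hx.1
    have h2 : 0 < 1 - x := by linarith [hx.2]
    have : (-1) ^ k * (x ^ j * (x - 1) ^ k * exp x) = x ^ j * (1 - x) ^ k * exp x := by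
      rw [show (1 - x) = (-1) * (x - 1) by ring, mul_pow]; ring
    rw [this]; positivity
  · norm_num

end Integrals

/-! ### Lagrange's best-approximation lemma -/

/-- **Lagrange's best-approximation lemma**, abstract form: if `A'B − AB' = ±1`, `B, B' > 0`
and `Bθ − A`, `B'θ − A'` have opposite signs, then `|qθ − p| ≥ |Bθ − A|` whenever
`0 < q < B'`. [folklore] -/
theorem lagrange_aux {θ : ℝ} {A B A' B' σ : ℤ} (hσ : σ = 1 ∨ σ = -1)
    (hdet : A' * B - A * B' = σ) (hB : 0 < B) (hB' : 0 < B')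
    (hopp : ((B : ℝ) * θ - A) * ((B' : ℝ) * θ - A') < 0)
    {p q : ℤ} (hq : 0 < q) (hqB' : q < B') :
    |(B : ℝ) * θ - A| ≤ |(q : ℝ) * θ - p| := by
  have hσ2 : σ * σ = 1 := by rcases hσ with rfl | rfl <;> norm_num
  obtain ⟨u, hu⟩ : ∃ u : ℤ, u = σ * (A' * q - p * B') := ⟨_, rfl⟩
  obtain ⟨v, hv⟩ : ∃ v : ℤ, v = σ * (B * p - A * q) := ⟨_, rfl⟩
  have hPeq : u * A + v * A' = p := by
    linear_combination A * hu + A' * hv + σ * p * hdet + p * hσ2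
  have hQeq : u * B + v * B' = q := by
    linear_combination B * hu + B' * hv + σ * q * hdet + q * hσ2
  have hPeq' : (u : ℝ) * A + v * A' = p := by exact_mod_cast hPeq
  have hQeq' : (u : ℝ) * B + v * B' = q := by exact_mod_cast hQeq
  have key : (q : ℝ) * θ - p = u * ((B : ℝ) * θ - A) + v * ((B' : ℝ) * θ - A') := by
    rw [← hPeq', ← hQeq']; ring
  rw [key]
  rcases eq_or_ne v 0 with hv0 | hv0
  · -- `v = 0`: then `q = uB`, so `u ≥ 1`.
    rw [hv0, zero_mul] at hQeq
    have hu1 : 1 ≤ u := by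
      by_contra hcon
      push Not at hcon
      nlinarith
    have hu1' : (1 : ℝ) ≤ |(u : ℝ)| := by
      have : (1 : ℝ) ≤ u := by exact_mod_cast hu1
      exact this.trans (le_abs_self _)
    rw [hv0, Int.cast_zero, zero_mul, add_zero, abs_mul]
    exact le_mul_of_one_le_left (abs_nonneg _) hu1'
  rcases eq_or_ne u 0 with hu0 | hu0
  · -- `u = 0`: then `q = vB' ≥ B'`, contradiction.
    exfalso
    rw [hu0, zero_mul, zero_add] at hQeq
    have hv1 : 1 ≤ v := by
      by_contra hcon
      push Not at hcon
      nlinarith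
    nlinarith
  -- both nonzero: `u v < 0`, and the two terms have the same sign.
  have huv : u * v < 0 := by
    rcases lt_or_gt_of_ne hv0 with hvneg | hvpos
    · have : 0 < u * B := by nlinarith
      have hu' : 0 < u := pos_of_mul_pos_left this hB.le
      exact mul_neg_of_pos_of_neg hu' hvneg
    · have : u * B < 0 := by nlinarith
      have hu' : u < 0 := by
        by_contra hcon; push Not at hcon; nlinarith
      exact mul_neg_of_neg_of_pos hu' hvpos
  have hprod : 0 < ((u : ℝ) * ((B : ℝ) * θ - A)) * ((v : ℝ) * ((B' : ℝ) * θ - A')) := by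
    have h1 : ((u : ℝ) * v) < 0 := by exact_mod_cast huv
    have : ((u : ℝ) * ((B : ℝ) * θ - A)) * ((v : ℝ) * ((B' : ℝ) * θ - A')) =
        ((u : ℝ) * v) * (((B : ℝ) * θ - A) * ((B' : ℝ) * θ - A')) := by ring
    rw [this]; exact mul_pos_of_neg_of_neg h1 hopp
  have hu1 : (1 : ℝ) ≤ |(u : ℝ)| := by
    have : (1 : ℤ) ≤ |u| := Int.one_le_abs hu0
    exact_mod_cast this
  calc |(B : ℝ) * θ - A| ≤ |(u : ℝ)| * |(B : ℝ) * θ - A| :=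
        le_mul_of_one_le_left (abs_nonneg _) hu1
    _ = |(u : ℝ) * ((B : ℝ) * θ - A)| := (abs_mul _ _).symm
    _ ≤ |(u : ℝ) * ((B : ℝ) * θ - A) + v * ((B' : ℝ) * θ - A')| := by
        rw [← sq_le_sq, add_sq]
        nlinarith [sq_nonneg ((v : ℝ) * ((B' : ℝ) * θ - A')), hprod]

/-! ### Elementary analysis of `log log q / log q` -/

/-- `e^e < 27`. [folklore] -/
theorem exp_exp_one_lt : exp (exp 1) < 27 := by
  calc exp (exp 1) < exp 3 := exp_lt_exp.mpr exp_one_lt_three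
    _ = exp 1 ^ 3 := by rw [← Real.exp_nat_mul]; norm_num
    _ < 3 ^ 3 := by gcongr; exact exp_one_lt_three
    _ = 27 := by norm_num

/-- `log log x / log x` is decreasing for `x ≥ 27 > e^e`. [folklore] -/
theorem loglog_div_log_anti {x y : ℝ} (hx : 27 ≤ x) (hxy : x ≤ y) :
    log (log y) / log y ≤ log (log x) / log x := by
  have hx0 : 0 < x := by linarith
  have hx1 : exp 1 ≤ log x := by
    rw [le_log_iff_exp_le hx0]; linarith [exp_exp_one_lt]
  have hxy' : log x ≤ log y := log_le_log hx0 hxy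
  exact log_div_self_antitoneOn hx1 (le_trans hx1 hxy') hxy'

/-- `log y ≤ y/2` for `y > 0`. [folklore] -/
theorem log_le_half {y : ℝ} (hy : 0 < y) : log y ≤ y / 2 := by
  have h1 : log y = log (y / 2) + log 2 := by
    rw [log_div hy.ne' two_ne_zero]; ring
  have h2 : log (y / 2) ≤ y / 2 - 1 := log_le_sub_one_of_pos (by positivity)
  have h3 : log 2 < 1 := by linarith [log_two_lt_d9]
  linarith

/-- For `x ≥ 27`: `1 < log x` and `0 ≤ log log x / log x ≤ 1/2`. [folklore] -/
theorem loglog_div_log_bounds {x : ℝ} (hx : 27 ≤ x) :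
    1 < log x ∧ 0 ≤ log (log x) / log x ∧ log (log x) / log x ≤ 1 / 2 := by
  have hx0 : 0 < x := by linarith
  have h1 : 1 < log x := by
    rw [lt_log_iff_exp_lt hx0]; linarith [exp_one_lt_three]
  have h0 : 0 < log x := by linarith
  refine ⟨h1, div_nonneg (log_nonneg h1.le) h0.le, ?_⟩
  rw [div_le_iff₀ h0]
  linarith [log_le_half h0]

/-- `log 8 > 2`. [folklore] -/
theorem two_lt_log_eight : (2 : ℝ) < log 8 := by
  have : log 8 = 3 * log 2 := by
    rw [show (8 : ℝ) = 2 ^ 3 by norm_num, log_pow]; norm_num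
  rw [this]; linarith [log_two_gt_d9]

/-- The auxiliary limit `((i+2)/i) (1 + log log (i+1) / log (i+1)) → 1`. [folklore] -/
theorem tendsto_aux :
    Tendsto (fun i : ℕ =>
      ((i : ℝ) + 2) / i * (1 + log (log ((i : ℝ) + 1)) / log ((i : ℝ) + 1))) atTop
      (𝓝 1) := by
  have h1 : Tendsto (fun i : ℕ => ((i : ℝ) + 2) / i) atTop (𝓝 1) := by
    have h : Tendsto (fun i : ℕ => 1 + 2 / (i : ℝ)) atTop (𝓝 (1 + 0)) :=
      tendsto_const_nhds.add (tendsto_const_div_atTop_nhds_zero_nat (2 : ℝ))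
    rw [add_zero] at h
    refine h.congr' ?_
    filter_upwards [eventually_gt_atTop 0] with i hi
    have : (i : ℝ) ≠ 0 := by positivity
    field_simp
  have h2 : Tendsto (fun i : ℕ => log (log ((i : ℝ) + 1)) / log ((i : ℝ) + 1))
      atTop (𝓝 0) := by
    have hl : Tendsto (fun i : ℕ => log ((i : ℝ) + 1)) atTop atTop :=
      tendsto_log_atTop.comp (tendsto_atTop_add_const_right atTop 1 tendsto_natCast_atTop_atTop)
    have h0 := tendsto_pow_log_div_mul_add_atTop 1 0 1 one_ne_zero
    simp only [pow_one, one_mul, add_zero] at h0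
    exact h0.comp hl
  have h3 : Tendsto (fun i : ℕ => 1 + log (log ((i : ℝ) + 1)) / log ((i : ℝ) + 1)) atTop
      (𝓝 (1 + 0)) := tendsto_const_nhds.add h2
  have := h1.mul h3
  simpa using this

/-- `(1 + 1/(i+1))^{i+1} ≤ e`, in the form `(i+2)^{i+1} ≤ 3 (i+1)^{i+1}`. [folklore] -/
theorem pow_succ_le_three_mul_pow (i : ℕ) :
    ((i : ℝ) + 1 + 1) ^ (i + 1) ≤ 3 * ((i : ℝ) + 1) ^ (i + 1) := by
  have hx : (0 : ℝ) < i + 1 := by positivity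
  have h2 : (1 + 1 / ((i : ℝ) + 1)) ^ (i + 1) ≤ exp 1 := by
    have h3 : 1 + 1 / ((i : ℝ) + 1) ≤ exp (1 / ((i : ℝ) + 1)) := by
      linarith [add_one_le_exp (1 / ((i : ℝ) + 1))]
    calc (1 + 1 / ((i : ℝ) + 1)) ^ (i + 1) ≤ (exp (1 / ((i : ℝ) + 1))) ^ (i + 1) := by
          gcongr
      _ = exp 1 := by
          rw [← Real.exp_nat_mul]; congr 1; push_cast; field_simp
  have h4 : ((i : ℝ) + 1 + 1) = ((i : ℝ) + 1) * (1 + 1 / ((i : ℝ) + 1)) := by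
    field_simp
  rw [h4, mul_pow]
  have := exp_one_lt_d9
  nlinarith [pow_pos hx (i + 1)]

/-! ### The convergents of `e = [1; 0, 1, 1, 2, 1, 1, 4, …]` -/

section Convergents

variable {a P Q : ℕ → ℕ}

/- HYPOTHESIS of this section: `a m` (`m ≥ 2`) are the partial quotients of
`e = [1; 0, 1, 1, 2, 1, 1, 4, …]` in Cohn's uniform indexing (`a_{3i+2} = a_{3i+3} = 1`,
`a_{3i+4} = 2i + 2`), and `P`, `Q` are the numerators and denominators `p_m`, `q_m` of its
convergents: `p_0 = p_1 = 1`, `q_0 = 1`, `q_1 = 0`, `p_{m+2} = a_{m+2} p_{m+1} + p_m`,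
`q_{m+2} = a_{m+2} q_{m+1} + q_m` (Cohn 2006, §1). The signed errors are
`d_m = q_m e − p_m`, written out as `(Q m : ℝ) * exp 1 - P m`. Instantiated in
`Davis1978_thm1_holds`. -/
variable (h : (∀ i : ℕ, a (3 * i + 2) = 1) ∧ (∀ i : ℕ, a (3 * i + 3) = 1) ∧
    (∀ i : ℕ, a (3 * i + 4) = 2 * i + 2) ∧
    P 0 = 1 ∧ P 1 = 1 ∧ (∀ m : ℕ, P (m + 2) = a (m + 2) * P (m + 1) + P m) ∧
    Q 0 = 1 ∧ Q 1 = 0 ∧ ∀ m : ℕ, Q (m + 2) = a (m + 2) * Q (m + 1) + Q m)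
include h

/-- `a_m ≥ 1` for `m ≥ 2`. [cite: Cohn2006, §1] -/
theorem one_le_quot (m : ℕ) : 1 ≤ a (m + 2) := by
  obtain ⟨ha2, ha3, ha4, -, -, -, -, -, -⟩ := h
  obtain ⟨i, r, hr, rfl⟩ : ∃ i r, r < 3 ∧ m = 3 * i + r :=
    ⟨m / 3, m % 3, Nat.mod_lt _ (by norm_num), (Nat.div_add_mod m 3).symm⟩
  interval_cases r
  · rw [show 3 * i + 0 + 2 = 3 * i + 2 by ring, ha2]
  · rw [show 3 * i + 1 + 2 = 3 * i + 3 by ring, ha3]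
  · rw [show 3 * i + 2 + 2 = 3 * i + 4 by ring, ha4]; omega

/-- The values `a_{3n+3} = 1`, `a_{3n+4} = 2n+2`, `a_{3n+5} = 1`, `a_{3n+6} = 1` in the index
forms used below. [cite: Cohn2006, §1] -/
theorem quot_values (n : ℕ) :
    a (3 * n + 3) = 1 ∧ a (3 * n + 4) = 2 * n + 2 ∧ a (3 * n + 5) = 1 ∧ a (3 * n + 6) = 1 := by
  obtain ⟨ha2, ha3, ha4, -, -, -, -, -, -⟩ := h
  refine ⟨ha3 n, ha4 n, ?_, ?_⟩
  · rw [show 3 * n + 5 = 3 * (n + 1) + 2 by ring, ha2]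
  · rw [show 3 * n + 6 = 3 * (n + 1) + 3 by ring, ha3]

/-- The recurrence for the errors `d_{m+2} = a_{m+2} d_{m+1} + d_m`. [cite: Cohn2006, §1] -/
theorem err_add_two (m : ℕ) :
    ((Q (m + 2) : ℝ) * exp 1 - P (m + 2)) =
      a (m + 2) * ((Q (m + 1) : ℝ) * exp 1 - P (m + 1)) + ((Q m : ℝ) * exp 1 - P m) := by
  obtain ⟨-, -, -, -, -, hP, -, -, hQ⟩ := h
  rw [hP m, hQ m]; push_cast; ring

/-- The determinant identity `p_{m+1} q_m − p_m q_{m+1} = (−1)^m`. [folklore] -/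
theorem num_den_det (m : ℕ) : (P (m + 1) : ℤ) * Q m - P m * Q (m + 1) = (-1) ^ m := by
  obtain ⟨-, -, -, hP0, hP1, hP, hQ0, hQ1, hQ⟩ := h
  induction m with
  | zero => simp [hP0, hP1, hQ0, hQ1]
  | succ m ih =>
    rw [show m + 1 + 1 = m + 2 from rfl, hP m, hQ m, pow_succ]
    push_cast
    linear_combination -ih

/-- **Cohn's Theorem** (`A_n = q_{3n} e − p_{3n}`, `B_n = p_{3n+1} − q_{3n+1} e`,
`C_n = p_{3n+2} − q_{3n+2} e`), in the form `M(n,n) = n! d_{3n}`, `M(n+1,n) = −n! d_{3n+1}`,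
`M(n,n+1) = −n! d_{3n+2}` for Hermite's integrals `M`. [cite: Cohn2006, §2, Theorem 1] -/
theorem H_eq_err {M : ℕ → ℕ → ℝ}
    (hM : ∀ j k : ℕ, M j k = ∫ x in (0:ℝ)..1, x ^ j * (x - 1) ^ k * exp x) (n : ℕ) :
    M n n = n ! * ((Q (3 * n) : ℝ) * exp 1 - P (3 * n)) ∧
      M (n + 1) n = -(n ! * ((Q (3 * n + 1) : ℝ) * exp 1 - P (3 * n + 1))) ∧
      M n (n + 1) = -(n ! * ((Q (3 * n + 2) : ℝ) * exp 1 - P (3 * n + 2))) := by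
  induction n with
  | zero =>
    obtain ⟨ha2, -, -, hP0, hP1, hP, hQ0, hQ1, hQ⟩ := h
    have h00 := H_zero_zero hM
    have h10 := H_one_zero hM
    have h01 : M 0 1 = 2 - exp 1 := by have := H_succ_sub hM 0 0; linarith
    have ha2' : a 2 = 1 := ha2 0
    have hP2 : P 2 = 2 := by rw [hP 0, hP0, hP1, ha2']
    have hQ2 : Q 2 = 1 := by rw [hQ 0, hQ0, hQ1, ha2']
    refine ⟨?_, ?_, ?_⟩
    · rw [show 3 * 0 = 0 from rfl, h00, hQ0, hP0]; simp
    · rw [show (0 : ℕ) + 1 = 1 from rfl, h10, hQ1, hP1]; simp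
    · rw [show (0 : ℕ) + 1 = 1 from rfl, show 3 * 0 + 2 = 2 from rfl, h01, hQ2, hP2]
      norm_num
  | succ n ih =>
    obtain ⟨hA, hB, hC⟩ := ih
    have r1 := H_rel hM n n
    have r2 := H_rel hM n (n + 1)
    have r3 := H_succ_sub hM n (n + 1)
    have r4 := H_succ_sub hM (n + 1) (n + 1)
    obtain ⟨c3, c4, c5, -⟩ := quot_values h n
    have e3 : ((Q (3 * n + 3) : ℝ) * exp 1 - P (3 * n + 3)) =
        ((Q (3 * n + 2) : ℝ) * exp 1 - P (3 * n + 2)) +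
          ((Q (3 * n + 1) : ℝ) * exp 1 - P (3 * n + 1)) := by
      rw [show 3 * n + 3 = (3 * n + 1) + 2 from rfl, err_add_two h, c3]; push_cast; ring
    have e4 : ((Q (3 * n + 4) : ℝ) * exp 1 - P (3 * n + 4)) =
        2 * (n + 1) * ((Q (3 * n + 3) : ℝ) * exp 1 - P (3 * n + 3)) +
          ((Q (3 * n + 2) : ℝ) * exp 1 - P (3 * n + 2)) := by
      rw [show 3 * n + 4 = (3 * n + 2) + 2 from rfl, err_add_two h, c4]; push_cast; ring
    have e5 : ((Q (3 * n + 5) : ℝ) * exp 1 - P (3 * n + 5)) =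
        ((Q (3 * n + 4) : ℝ) * exp 1 - P (3 * n + 4)) +
          ((Q (3 * n + 3) : ℝ) * exp 1 - P (3 * n + 3)) := by
      rw [show 3 * n + 5 = (3 * n + 3) + 2 from rfl, err_add_two h, c5]; push_cast; ring
    have hf : ((n + 1)! : ℝ) = (n + 1) * n ! := by push_cast [Nat.factorial_succ]; ring
    have eq1 : 3 * (n + 1) = 3 * n + 3 := by ring
    have eq2 : 3 * (n + 1) + 1 = 3 * n + 4 := by ring
    have eq3 : 3 * (n + 1) + 2 = 3 * n + 5 := by ring
    have eq4 : n + 1 + 1 = n + 2 := rfl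
    rw [eq2, eq3, eq1, eq4, hf]
    rw [eq4] at r2 r4
    refine ⟨?_, ?_, ?_⟩
    · rw [e3]; linear_combination r1 - ((n:ℝ) + 1) * hC - ((n:ℝ) + 1) * hB
    · rw [e4, e3]; push_cast at r1 r2 ⊢
      linear_combination r4 + r2 + ((n:ℝ) + 1) * r3 - (2 * (n:ℝ) + 2) * r1
        + ((2 * (n:ℝ) + 2) * (n + 1) + (n + 1)) * hC + (2 * (n:ℝ) + 2) * (n + 1) * hB
    · rw [e5, e4, e3]; push_cast at r1 r2 ⊢
      linear_combination r2 + ((n:ℝ) + 1) * r3 - (2 * (n:ℝ) + 3) * r1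
        + ((2 * (n:ℝ) + 3) * (n + 1) + (n + 1)) * hC + (2 * (n:ℝ) + 3) * (n + 1) * hB

/-- The errors alternate in sign: `(−1)^m d_m > 0`. [cite: Cohn2006, §2] -/
theorem err_sign (m : ℕ) : 0 < (-1) ^ m * ((Q m : ℝ) * exp 1 - P m) := by
  -- Hermite's integrals
  obtain ⟨M, hM⟩ : ∃ M : ℕ → ℕ → ℝ,
      ∀ j k : ℕ, M j k = ∫ x in (0:ℝ)..1, x ^ j * (x - 1) ^ k * exp x := by
    exact ⟨fun j k => ∫ x in (0:ℝ)..1, x ^ j * (x - 1) ^ k * exp x, fun _ _ => rfl⟩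
  obtain ⟨n, r, hr, rfl⟩ : ∃ n r, r < 3 ∧ m = 3 * n + r :=
    ⟨m / 3, m % 3, Nat.mod_lt _ (by norm_num), (Nat.div_add_mod m 3).symm⟩
  obtain ⟨hA, hB, hC⟩ := H_eq_err h hM n
  have hfact : (0:ℝ) < n ! := by positivity
  have h3 : ((-1:ℝ) ^ (3 * n)) = (-1) ^ n := by
    rw [pow_mul]; norm_num
  interval_cases r
  · have hs := H_sign hM n n
    rw [hA] at hs
    rw [add_zero, h3]
    have : 0 < (n ! : ℝ) * ((-1) ^ n * ((Q (3 * n) : ℝ) * exp 1 - P (3 * n))) := by linarith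
    exact pos_of_mul_pos_right this hfact.le
  · have hs := H_sign hM (n + 1) n
    rw [hB] at hs
    rw [pow_succ, h3]
    have : 0 < (n ! : ℝ) * ((-1) ^ n * (-1) * ((Q (3 * n + 1) : ℝ) * exp 1 - P (3 * n + 1))) := by
      linarith
    exact pos_of_mul_pos_right this hfact.le
  · have hs := H_sign hM n (n + 1)
    rw [hC, pow_succ] at hs
    rw [pow_succ, pow_succ, h3]
    have : 0 < (n ! : ℝ) *
        ((-1) ^ n * (-1) * (-1) * ((Q (3 * n + 2) : ℝ) * exp 1 - P (3 * n + 2))) := by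
      linarith
    exact pos_of_mul_pos_right this hfact.le

/-- `|d_m| = (−1)^m d_m`. [cite: Cohn2006, §2] -/
theorem abs_err (m : ℕ) : |((Q m : ℝ) * exp 1 - P m)| = (-1) ^ m * ((Q m : ℝ) * exp 1 - P m) := by
  have hs := err_sign h m
  rcases neg_one_pow_eq_or ℝ m with h1 | h1 <;> rw [h1] at hs ⊢
  · rw [one_mul]; exact abs_of_pos (by linarith)
  · rw [abs_of_neg (by linarith)]; ring

/-- Consecutive errors have opposite signs. [folklore] -/
theorem err_mul_err_succ_neg (m : ℕ) :
    ((Q m : ℝ) * exp 1 - P m) * ((Q (m + 1) : ℝ) * exp 1 - P (m + 1)) < 0 := by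
  have h1 := err_sign h m
  have h2 := err_sign h (m + 1)
  rw [pow_succ] at h2
  have hsq : ((-1 : ℝ) ^ m) ^ 2 = 1 := by rw [← pow_mul, mul_comm, pow_mul]; norm_num
  nlinarith [mul_pos h1 h2]

/-- `e` lies strictly between consecutive convergents, quantitatively:
`q_{m+1} |d_m| + q_m |d_{m+1}| = 1`. [folklore] -/
theorem den_abs_err (m : ℕ) :
    (Q (m + 1) : ℝ) * |(Q m : ℝ) * exp 1 - P m| + Q m * |(Q (m + 1) : ℝ) * exp 1 - P (m + 1)| =
      1 := by
  rw [abs_err h, abs_err h, pow_succ]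
  have hdet' : (P (m + 1) : ℝ) * Q m - P m * Q (m + 1) = (-1) ^ m := by
    exact_mod_cast num_den_det h m
  have hsq : ((-1 : ℝ) ^ m) ^ 2 = 1 := by rw [← pow_mul, mul_comm, pow_mul]; norm_num
  linear_combination ((-1:ℝ) ^ m) * hdet' + hsq

/-- `q_{m+1} |d_m| ≤ 1`. [folklore] -/
theorem den_succ_mul_abs_err_le (m : ℕ) : (Q (m + 1) : ℝ) * |((Q m : ℝ) * exp 1 - P m)| ≤ 1 := by
  have h1 := den_abs_err h m
  have : 0 ≤ (Q m : ℝ) * |((Q (m + 1) : ℝ) * exp 1 - P (m + 1))| := by positivity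
  linarith

/-! ### Growth of the denominators -/

/-- `q_2 = q_3 = 1`. [cite: Cohn2006, §1] -/
theorem den_two_three : Q 2 = 1 ∧ Q 3 = 1 := by
  obtain ⟨ha2, ha3, -, -, -, -, hQ0, hQ1, hQ⟩ := h
  have h2 : Q 2 = 1 := by rw [hQ 0, hQ0, hQ1, ha2 0]
  refine ⟨h2, ?_⟩
  rw [show (3 : ℕ) = 1 + 2 from rfl, hQ 1, h2, hQ1, ha3 0]

/-- `q_{m+2} > 0`. [folklore] -/
theorem den_pos (m : ℕ) : 0 < Q (m + 2) := by
  obtain ⟨h2, h3⟩ := den_two_three h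
  obtain ⟨-, -, -, -, -, -, -, -, hQ⟩ := h
  induction m using Nat.twoStepInduction with
  | zero => show 0 < Q 2; omega
  | one => show 0 < Q 3; omega
  | more n ih1 _ => rw [hQ]; exact Nat.add_pos_right _ ih1

/-- `q_{m+1} ≤ q_{m+2}`. [folklore] -/
theorem den_succ_le (m : ℕ) : Q (m + 1) ≤ Q (m + 2) := by
  have := one_le_quot h m
  obtain ⟨-, -, -, -, -, -, -, -, hQ⟩ := h
  rw [hQ m]
  calc Q (m + 1) = 1 * Q (m + 1) := (one_mul _).symm
    _ ≤ a (m + 2) * Q (m + 1) := Nat.mul_le_mul_right _ this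
    _ ≤ _ := Nat.le_add_right _ _

/-- The denominators are monotone from index `1` on. [folklore] -/
theorem den_mono {m m' : ℕ} (h1 : 1 ≤ m) (h2 : m ≤ m') : Q m ≤ Q m' := by
  induction m', h2 using Nat.le_induction with
  | base => exact le_rfl
  | succ k hk ih =>
    obtain ⟨j, rfl⟩ : ∃ j, k = j + 1 := ⟨k - 1, by omega⟩
    exact ih.trans (den_succ_le h j)

/-- `q_{m+3} ≤ (a_{m+3} + 1) q_{m+2}`. [folklore] -/
theorem den_le_succ_mul (m : ℕ) : Q (m + 3) ≤ (a (m + 3) + 1) * Q (m + 2) := by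
  have hle : Q (m + 1) ≤ Q (m + 2) := den_succ_le h m
  obtain ⟨-, -, -, -, -, -, -, -, hQ⟩ := h
  have e : Q (m + 3) = a (m + 3) * Q (m + 2) + Q (m + 1) := hQ (m + 1)
  rw [e, add_mul, one_mul]
  exact Nat.add_le_add_left hle _

/-- `a_{m+2} q_{m+1} ≤ q_{m+2}`. [folklore] -/
theorem quot_mul_den_le (m : ℕ) : a (m + 2) * Q (m + 1) ≤ Q (m + 2) := by
  obtain ⟨-, -, -, -, -, -, -, -, hQ⟩ := h
  rw [hQ m]; exact Nat.le_add_right _ _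

/-- `(q_{m+2} + q_{m+1}) |d_{m+1}| ≥ 1`: the classical lower bound
`|e − p_m/q_m| ≥ 1/(q_m (q_{m+1} + q_m))`. [folklore] -/
theorem one_le_den_add_mul_abs_err (m : ℕ) :
    1 ≤ ((Q (m + 2) : ℝ) + Q (m + 1)) * |((Q (m + 1) : ℝ) * exp 1 - P (m + 1))| := by
  have h1 := den_abs_err h (m + 1)
  have h2 := den_succ_mul_abs_err_le h (m + 2)
  have hc : (1 : ℝ) ≤ a (m + 3) := by exact_mod_cast one_le_quot h (m + 1)
  have hpos : (0 : ℝ) < Q (m + 2) := by exact_mod_cast den_pos h m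
  have e3 : ((Q (m + 3) : ℕ) : ℝ) = a (m + 3) * Q (m + 2) + Q (m + 1) := by
    obtain ⟨-, -, -, -, -, -, -, -, hQ⟩ := h
    rw [show Q (m + 3) = _ from hQ (m + 1)]; push_cast; ring
  have ha : 0 ≤ |((Q (m + 1) : ℝ) * exp 1 - P (m + 1))| := abs_nonneg _
  have hb : 0 ≤ |((Q (m + 2) : ℝ) * exp 1 - P (m + 2))| := abs_nonneg _
  have hd1 : (0 : ℝ) ≤ Q (m + 1) := by positivity
  rw [show (m + 2 + 1) = m + 3 from rfl] at h2
  rw [show (m + 1 + 1) = m + 2 from rfl] at h1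
  rw [e3] at h2
  have key : (Q (m + 2) : ℝ) * 1 ≤ (Q (m + 2) : ℝ) *
      (((Q (m + 2) : ℝ) + Q (m + 1)) * |((Q (m + 1) : ℝ) * exp 1 - P (m + 1))|) := by
    nlinarith [mul_nonneg hd1 hb, mul_nonneg (mul_nonneg hd1 hb) hpos.le,
      mul_nonneg (sub_nonneg.mpr hc) (mul_nonneg hpos.le (mul_nonneg hd1 ha))]
  exact le_of_mul_le_mul_left key hpos

/-- Lagrange's lemma for the convergents of `e`: if `0 < q < q_{m+3}` then
`|q e − p| ≥ |d_{m+2}|`. [folklore] -/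
theorem abs_err_le_of_lt_den (m : ℕ) {p q : ℤ} (hq : 0 < q) (hlt : q < Q (m + 3)) :
    |((Q (m + 2) : ℝ) * exp 1 - P (m + 2))| ≤ |(q : ℝ) * exp 1 - p| := by
  have hdet := num_den_det h (m + 2)
  have hopp := err_mul_err_succ_neg h (m + 2)
  have hl := lagrange_aux (θ := exp 1) (A := P (m + 2)) (B := Q (m + 2)) (A' := P (m + 3))
    (B' := Q (m + 3)) (σ := (-1) ^ (m + 2)) (neg_one_pow_eq_or ℤ (m + 2)) hdet
    (by exact_mod_cast den_pos h m) (by exact_mod_cast den_pos h (m + 1))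
    (by push_cast; exact hopp) (p := p) hq hlt
  simpa using hl

/-- The three-step recurrence `q_{3i+6} = (4i+5) q_{3i+3} + 2 q_{3i+2}` (Davis: `Q_{n+1}` from
`Q_n, S_n, U_n`, Lemma 1). [cite: Davis1978, Lemma 1] -/
theorem den_big_step (i : ℕ) :
    Q (3 * i + 6) = (4 * i + 5) * Q (3 * i + 3) + 2 * Q (3 * i + 2) := by
  obtain ⟨-, c4, c5, c6⟩ := quot_values h i
  obtain ⟨-, -, -, -, -, -, -, -, hQ⟩ := h
  have e4 : Q (3 * i + 4) = a (3 * i + 4) * Q (3 * i + 3) + Q (3 * i + 2) := hQ _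
  have e5 : Q (3 * i + 5) = a (3 * i + 5) * Q (3 * i + 4) + Q (3 * i + 3) := hQ _
  have e6 : Q (3 * i + 6) = a (3 * i + 6) * Q (3 * i + 5) + Q (3 * i + 4) := hQ _
  rw [e6, e5, e4, c4, c5, c6]; ring

/-- `(4i+5) q_{3i+3} ≤ q_{3i+6}`. [cite: Davis1978, Lemma 3] -/
theorem den_big_ge (i : ℕ) : (4 * i + 5) * Q (3 * i + 3) ≤ Q (3 * i + 6) := by
  rw [den_big_step h]; exact Nat.le_add_right _ _

/-- `q_{3i+6} ≤ (4i+7) q_{3i+3}`. [cite: Davis1978, Lemma 3] -/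
theorem den_big_le (i : ℕ) : Q (3 * i + 6) ≤ (4 * i + 7) * Q (3 * i + 3) := by
  rw [den_big_step h]
  have h1 : Q (3 * i + 2) ≤ Q (3 * i + 3) := den_succ_le h (3 * i + 1)
  nlinarith

/-- The big denominators are strictly increasing. [cite: Davis1978, Lemma 3] -/
theorem den_big_strictMono : StrictMono (fun i : ℕ => Q (3 * i + 3)) := by
  apply strictMono_nat_of_lt_succ
  intro i
  have h1 := den_big_ge h i
  have h2 : 0 < Q (3 * i + 3) := den_pos h (3 * i + 1)
  show Q (3 * i + 3) < Q (3 * (i + 1) + 3)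
  rw [show 3 * (i + 1) + 3 = 3 * i + 6 by ring]
  nlinarith

/-- Lower growth: `(i+1)^i ≤ q_{3i+3}`. [cite: Davis1978, Lemma 3] -/
theorem pow_le_den_big (i : ℕ) : ((i : ℝ) + 1) ^ i ≤ Q (3 * i + 3) := by
  induction i with
  | zero => simp [(den_two_three h).2]
  | succ i ih =>
    have hstep : ((4 * i + 5 : ℕ) : ℝ) * Q (3 * i + 3) ≤ Q (3 * (i + 1) + 3) := by
      rw [show 3 * (i + 1) + 3 = 3 * i + 6 by ring]; exact_mod_cast den_big_ge h i
    have hx : (0 : ℝ) < i + 1 := by positivity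
    push_cast at hstep ⊢
    calc ((i : ℝ) + 1 + 1) ^ (i + 1) ≤ 3 * ((i : ℝ) + 1) ^ (i + 1) :=
          pow_succ_le_three_mul_pow i
      _ = (3 * ((i : ℝ) + 1)) * ((i : ℝ) + 1) ^ i := by ring
      _ ≤ (4 * (i : ℝ) + 5) * Q (3 * i + 3) := by
          apply mul_le_mul _ ih (by positivity) (by positivity)
          linarith
      _ ≤ _ := hstep

/-- Upper growth: `q_{3i+3} ≤ (8(i+1))^i`. [cite: Davis1978, Lemma 3] -/
theorem den_big_le_pow (i : ℕ) : (Q (3 * i + 3) : ℝ) ≤ (8 * ((i : ℝ) + 1)) ^ i := by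
  induction i with
  | zero => simp [(den_two_three h).2]
  | succ i ih =>
    have hstep : (Q (3 * (i + 1) + 3) : ℝ) ≤ ((4 * i + 7 : ℕ) : ℝ) * Q (3 * i + 3) := by
      rw [show 3 * (i + 1) + 3 = 3 * i + 6 by ring]; exact_mod_cast den_big_le h i
    push_cast at hstep ⊢
    calc (Q (3 * (i + 1) + 3) : ℝ) ≤ (4 * (i : ℝ) + 7) * Q (3 * i + 3) := hstep
      _ ≤ (8 * ((i : ℝ) + 1)) * (8 * ((i : ℝ) + 1)) ^ i := by
          apply mul_le_mul _ ih (by positivity) (by positivity); linarith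
      _ = (8 * ((i : ℝ) + 1)) ^ (i + 1) := by ring
      _ ≤ (8 * ((i : ℝ) + 1 + 1)) ^ (i + 1) := by gcongr; linarith

/-- For `i ≥ 3`, `q_{3i+3} ≥ 64`. [cite: Davis1978, Lemma 3] -/
theorem den_big_ge_64 {i : ℕ} (hi : 3 ≤ i) : (64 : ℝ) ≤ Q (3 * i + 3) := by
  have h1 : (4 : ℝ) ^ i ≤ ((i : ℝ) + 1) ^ i := by
    apply pow_le_pow_left₀ (by norm_num)
    have : (3 : ℝ) ≤ i := by exact_mod_cast hi
    linarith
  have h2 : (4 : ℝ) ^ 3 ≤ 4 ^ i := pow_le_pow_right₀ (by norm_num) hi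
  calc (64 : ℝ) = 4 ^ 3 := by norm_num
    _ ≤ 4 ^ i := h2
    _ ≤ ((i : ℝ) + 1) ^ i := h1
    _ ≤ _ := pow_le_den_big h i

/-! ### The two estimates of Davis's proof -/

/-- Davis's relation (3), upper form: for the convergents `p_{3i+3}/q_{3i+3}` (next partial
quotient `2i+2`), `|e − p/q| ≤ 1/((2i+2) q²) < (½ + ε) log log q /(q² log q)` as soon as
`2ε log (i+1) > log 8` (and `i ≥ 3`). [cite: Davis1978, proof of Thm 1, (3)] -/
theorem upper_estimate {ε : ℝ} (hε : 0 < ε) {i : ℕ} (hi3 : 3 ≤ i)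
    (hi : log 8 < 2 * ε * log ((i : ℝ) + 1)) :
    |exp 1 - ((P (3 * i + 3) : ℤ) : ℝ) / (Q (3 * i + 3) : ℝ)| <
      (1 / 2 + ε) * log (log (Q (3 * i + 3) : ℝ)) /
        ((Q (3 * i + 3) : ℝ) ^ 2 * log (Q (3 * i + 3) : ℝ)) := by
  set D : ℝ := (Q (3 * i + 3) : ℝ) with hD
  have hD64 : (64 : ℝ) ≤ D := den_big_ge_64 h hi3
  have hD0 : (0 : ℝ) < D := by linarith
  have hi0 : (0 : ℝ) < i := by exact_mod_cast (show 0 < i by omega)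
  have hx : (0 : ℝ) < i + 1 := by positivity
  -- the error of the convergent
  have herr :
      ((2 * (i : ℝ) + 2) * D) * |((Q (3 * i + 3) : ℝ) * exp 1 - P (3 * i + 3))| ≤ 1 := by
    have h1 := den_succ_mul_abs_err_le h (3 * i + 3)
    have h2 : (2 * i + 2) * Q (3 * i + 3) ≤ Q (3 * i + 4) := by
      have c4 : a (3 * i + 4) = 2 * i + 2 := (quot_values h i).2.1
      have := quot_mul_den_le h (3 * i + 2)
      rwa [show 3 * i + 2 + 2 = 3 * i + 4 from rfl, c4] at this
    have h2' : (2 * (i : ℝ) + 2) * D ≤ Q (3 * i + 4) := by rw [hD]; exact_mod_cast h2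
    calc ((2 * (i : ℝ) + 2) * D) * |((Q (3 * i + 3) : ℝ) * exp 1 - P (3 * i + 3))|
        ≤ (Q (3 * i + 4) : ℝ) * |((Q (3 * i + 3) : ℝ) * exp 1 - P (3 * i + 3))| :=
          mul_le_mul_of_nonneg_right h2' (abs_nonneg _)
      _ ≤ 1 := h1
  have hrew : |exp 1 - ((P (3 * i + 3) : ℤ) : ℝ) / D| =
      |((Q (3 * i + 3) : ℝ) * exp 1 - P (3 * i + 3))| / D := by
    rw [show exp 1 - ((P (3 * i + 3) : ℤ) : ℝ) / D =
      ((Q (3 * i + 3) : ℝ) * exp 1 - P (3 * i + 3)) / D by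
      rw [← hD]; field_simp; push_cast; ring]
    rw [abs_div, abs_of_pos hD0]
  rw [hrew]
  -- logs: y = log D between L = i log (i+1) and U = i log (8 (i+1))
  have hlog4 : 1 ≤ log ((i : ℝ) + 1) := by
    rw [le_log_iff_exp_le hx]
    have : (3 : ℝ) ≤ i := by exact_mod_cast hi3
    linarith [exp_one_lt_three]
  have hL : (i : ℝ) * log ((i : ℝ) + 1) ≤ log D := by
    have := log_le_log (pow_pos hx i) (pow_le_den_big h i)
    rwa [log_pow] at this
  have hU : log D ≤ (i : ℝ) * log (8 * ((i : ℝ) + 1)) := by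
    have := log_le_log hD0 (den_big_le_pow h i)
    rwa [log_pow] at this
  have hLe : exp 1 ≤ (i : ℝ) * log ((i : ℝ) + 1) := by
    have : (3 : ℝ) ≤ i := by exact_mod_cast hi3
    nlinarith [exp_one_lt_three]
  set U : ℝ := (i : ℝ) * log (8 * ((i : ℝ) + 1)) with hUdef
  have hlog8U : log (8 * ((i : ℝ) + 1)) = log 8 + log ((i : ℝ) + 1) := by
    rw [log_mul (by norm_num) hx.ne']
  have hUpos : (i : ℝ) + 1 ≤ U := by
    have hi1 : (1 : ℝ) ≤ i := by exact_mod_cast (show 1 ≤ i by omega)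
    rw [hUdef, hlog8U]; nlinarith [two_lt_log_eight]
  have hU0 : 0 < U := by linarith
  have hanti : log U / U ≤ log (log D) / log D :=
    log_div_self_antitoneOn (le_trans hLe hL) (le_trans (le_trans hLe hL) hU) hU
  have hlogU : log ((i : ℝ) + 1) ≤ log U := log_le_log hx hUpos
  -- main inequality: U < (1 + 2ε)(i+1) log U
  have hmain : U < (1 + 2 * ε) * ((i : ℝ) + 1) * log U := by
    have h1 : (1 + 2 * ε) * ((i : ℝ) + 1) * log ((i : ℝ) + 1) ≤
        (1 + 2 * ε) * ((i : ℝ) + 1) * log U :=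
      mul_le_mul_of_nonneg_left hlogU (by positivity)
    have h2 : U < (1 + 2 * ε) * ((i : ℝ) + 1) * log ((i : ℝ) + 1) := by
      rw [hUdef, hlog8U]
      nlinarith [mul_pos hi0 (show (0:ℝ) < 2 * ε * log ((i : ℝ) + 1) - log 8 by linarith),
        mul_pos hε (show (0:ℝ) < log ((i : ℝ) + 1) by linarith)]
    linarith
  -- conclude
  have hgoal : 1 / ((2 * (i : ℝ) + 2)) < (1 / 2 + ε) * (log (log D) / log D) := by
    have h1 : 1 / ((2 * (i : ℝ) + 2)) < (1 / 2 + ε) * (log U / U) := by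
      rw [div_lt_iff₀ (by positivity)]
      rw [show (1 / 2 + ε) * (log U / U) * (2 * (i : ℝ) + 2) =
        ((1 + 2 * ε) * ((i : ℝ) + 1) * log U) / U by field_simp]
      rw [lt_div_iff₀ hU0]; linarith
    have h2 : (1 / 2 + ε) * (log U / U) ≤ (1 / 2 + ε) * (log (log D) / log D) :=
      mul_le_mul_of_nonneg_left hanti (by positivity)
    linarith
  calc |((Q (3 * i + 3) : ℝ) * exp 1 - P (3 * i + 3))| / D ≤ (1 / ((2 * (i : ℝ) + 2) * D)) / D := by
        gcongr
        rw [le_div_iff₀ (by positivity)]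
        linarith [herr]
    _ = (1 / (2 * (i : ℝ) + 2)) / (D ^ 2) := by field_simp
    _ < (1 / 2 + ε) * (log (log D) / log D) / D ^ 2 := by gcongr
    _ = _ := by field_simp

/-- Davis's relation (3), lower form, as an eventual statement: for `m` large,
`(½ − ε) (log log q_m / log q_m) (a_{m+1} + 2) < 1` (for the big convergents this is
`log q_{3i+3} ~ i log i`; for the others `a_{m+1} = 1`). [cite: Davis1978, proof of Thm 1] -/
theorem lower_threshold {ε : ℝ} (hε : 0 < ε) : ∃ m₀ : ℕ, ∀ m, m₀ ≤ m →
    (27 : ℝ) ≤ Q (m + 2) ∧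
      (1 / 2 - ε) * (log (log (Q (m + 2) : ℝ)) / log (Q (m + 2) : ℝ)) *
        (a (m + 3) + 2) < 1 := by
  -- the big convergents
  have big : ∃ i₀ : ℕ, 3 ≤ i₀ ∧ ∀ i, i₀ ≤ i →
      (1 / 2 - ε) * (log (log (Q (3 * i + 3) : ℝ)) / log (Q (3 * i + 3) : ℝ)) *
        (2 * i + 4) < 1 := by
    rcases le_or_gt (1 / 2 - ε) 0 with hε' | hε'
    · refine ⟨3, le_rfl, fun i hi => ?_⟩
      obtain ⟨-, hφ0, -⟩ := loglog_div_log_bounds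
        (show (27 : ℝ) ≤ Q (3 * i + 3) by linarith [den_big_ge_64 h hi])
      have : (1 / 2 - ε) * (log (log (Q (3 * i + 3) : ℝ)) / log (Q (3 * i + 3) : ℝ)) *
          (2 * i + 4) ≤ 0 := by
        apply mul_nonpos_of_nonpos_of_nonneg _ (by positivity)
        exact mul_nonpos_of_nonpos_of_nonneg hε' hφ0
      linarith
    · have hlt : (1 : ℝ) < 1 / (1 - 2 * ε) := by
        rw [lt_div_iff₀ (by linarith)]; linarith
      obtain ⟨i₁, hi₁⟩ := eventually_atTop.mp (tendsto_aux.eventually_lt_const hlt)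
      refine ⟨max 3 i₁, le_max_left _ _, fun i hi => ?_⟩
      have hi3 : 3 ≤ i := le_trans (le_max_left _ _) hi
      have hF := hi₁ i (le_trans (le_max_right _ _) hi)
      set D : ℝ := (Q (3 * i + 3) : ℝ) with hD
      have hD64 : (64 : ℝ) ≤ D := den_big_ge_64 h hi3
      have hD0 : (0 : ℝ) < D := by linarith
      have hi0 : (0 : ℝ) < i := by exact_mod_cast (show 0 < i by omega)
      have hx : (0 : ℝ) < i + 1 := by positivity
      have hlog4 : 1 ≤ log ((i : ℝ) + 1) := by
        rw [le_log_iff_exp_le hx]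
        have : (3 : ℝ) ≤ i := by exact_mod_cast hi3
        linarith [exp_one_lt_three]
      set t : ℝ := log ((i : ℝ) + 1) with ht
      have ht0 : 0 < t := by linarith
      have hL : (i : ℝ) * t ≤ log D := by
        have := log_le_log (pow_pos hx i) (pow_le_den_big h i)
        rwa [log_pow] at this
      have hLe : exp 1 ≤ (i : ℝ) * t := by
        have : (3 : ℝ) ≤ i := by exact_mod_cast hi3
        nlinarith [exp_one_lt_three]
      have hLpos : 0 < (i : ℝ) * t := by positivity
      have hanti : log (log D) / log D ≤ log ((i : ℝ) * t) / ((i : ℝ) * t) :=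
        log_div_self_antitoneOn hLe (le_trans hLe hL) hL
      have hlogL : log ((i : ℝ) * t) ≤ t + log t := by
        rw [log_mul hi0.ne' ht0.ne']
        have : log (i : ℝ) ≤ t := log_le_log hi0 (by linarith)
        linarith
      have hF' : ((i : ℝ) + 2) / i * (1 + log t / t) * (1 - 2 * ε) < 1 := by
        have := (lt_div_iff₀ (show (0 : ℝ) < 1 - 2 * ε by linarith)).mp hF
        simpa [ht] using this
      calc (1 / 2 - ε) * (log (log D) / log D) * (2 * i + 4)
          ≤ (1 / 2 - ε) * (log ((i : ℝ) * t) / ((i : ℝ) * t)) * (2 * i + 4) := by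
            gcongr
        _ ≤ (1 / 2 - ε) * ((t + log t) / ((i : ℝ) * t)) * (2 * i + 4) := by
            gcongr
        _ = ((i : ℝ) + 2) / i * (1 + log t / t) * (1 - 2 * ε) := by
            field_simp; ring
        _ < 1 := hF'
  obtain ⟨i₀, hi₀3, hbig⟩ := big
  refine ⟨3 * i₀ + 1, fun m hm => ?_⟩
  obtain ⟨i, r, hr, hi, rfl⟩ : ∃ i r, r < 3 ∧ i₀ ≤ i ∧ m = 3 * i + 1 + r :=
    ⟨(m - 1) / 3, (m - 1) % 3, Nat.mod_lt _ (by norm_num), by omega, by omega⟩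
  have hi3 : 3 ≤ i := le_trans hi₀3 hi
  have h64 : (64 : ℝ) ≤ Q (3 * i + 3) := den_big_ge_64 h hi3
  have hmono : Q (3 * i + 3) ≤ Q (3 * i + 1 + r + 2) := den_mono h (by omega) (by omega)
  have hmono' : (Q (3 * i + 3) : ℝ) ≤ Q (3 * i + 1 + r + 2) := by exact_mod_cast hmono
  have h27 : (27 : ℝ) ≤ Q (3 * i + 1 + r + 2) := by linarith
  refine ⟨h27, ?_⟩
  -- the case of next partial quotient 1
  have small : a (3 * i + 1 + r + 3) = 1 →
      (1 / 2 - ε) *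
        (log (log (Q (3 * i + 1 + r + 2) : ℝ)) / log (Q (3 * i + 1 + r + 2) : ℝ)) *
        (a (3 * i + 1 + r + 3) + 2) < 1 := by
    intro hc
    rw [hc]
    obtain ⟨-, hφ0, hφ⟩ := loglog_div_log_bounds h27
    push_cast
    nlinarith
  obtain ⟨-, c4, c5, c6⟩ := quot_values h i
  interval_cases r
  · have e2 : 3 * i + 1 + 0 + 2 = 3 * i + 3 := by ring
    have e3 : 3 * i + 1 + 0 + 3 = 3 * i + 4 := by ring
    rw [e2, e3, c4]
    have := hbig i hi
    push_cast
    convert this using 2; ring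
  · exact small (by rw [show 3 * i + 1 + 1 + 3 = 3 * i + 5 by ring, c5])
  · exact small (by rw [show 3 * i + 1 + 2 + 3 = 3 * i + 6 by ring, c6])

/-- The lower estimate on one interval `q_{m+2} ≤ q < q_{m+3}`: Lagrange's lemma plus
`|d_{m+2}| ≥ 1/(q_{m+3} + q_{m+2}) ≥ 1/((a_{m+3}+2) q_{m+2})`.
[cite: Davis1978, proof of Thm 1] -/
theorem lower_estimate {ε : ℝ} (m : ℕ) (h27 : (27 : ℝ) ≤ Q (m + 2))
    (hcond : (1 / 2 - ε) * (log (log (Q (m + 2) : ℝ)) / log (Q (m + 2) : ℝ)) *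
      (a (m + 3) + 2) < 1)
    {p : ℤ} {q : ℕ} (hqm : Q (m + 2) ≤ q) (hlt : q < Q (m + 3)) :
    (1 / 2 - ε) * log (log (q : ℝ)) / ((q : ℝ) ^ 2 * log (q : ℝ)) <
      |exp 1 - (p : ℝ) / q| := by
  set D : ℝ := (Q (m + 2) : ℝ) with hD
  have hD0 : (0 : ℝ) < D := by linarith
  have hqD : D ≤ (q : ℝ) := by rw [hD]; exact_mod_cast hqm
  have hq0 : (0 : ℝ) < q := by linarith
  have hq27 : (27 : ℝ) ≤ q := by linarith
  -- Lagrange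
  have hlag : |((Q (m + 2) : ℝ) * exp 1 - P (m + 2))| ≤ |(q : ℝ) * exp 1 - p| := by
    have hl := abs_err_le_of_lt_den h m (p := p) (q := (q : ℤ)) (by exact_mod_cast hq0)
      (by exact_mod_cast hlt)
    simpa using hl
  -- the lower bound for |d_{m+2}|
  have herr : 1 ≤ ((Q (m + 3) : ℝ) + D) * |((Q (m + 2) : ℝ) * exp 1 - P (m + 2))| :=
    one_le_den_add_mul_abs_err h (m + 1)
  have hden3 : (Q (m + 3) : ℝ) ≤ (a (m + 3) + 1) * D := by
    rw [hD]; exact_mod_cast den_le_succ_mul h m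
  have hc0 : (0 : ℝ) ≤ a (m + 3) := by positivity
  have step3 : 1 / ((a (m + 3) + 2) * D) ≤ |((Q (m + 2) : ℝ) * exp 1 - P (m + 2))| := by
    rw [div_le_iff₀ (by positivity)]
    calc 1 ≤ ((Q (m + 3) : ℝ) + D) * |((Q (m + 2) : ℝ) * exp 1 - P (m + 2))| := herr
      _ ≤ ((a (m + 3) + 2) * D) * |((Q (m + 2) : ℝ) * exp 1 - P (m + 2))| := by
          apply mul_le_mul_of_nonneg_right _ (abs_nonneg _); linarith
      _ = |((Q (m + 2) : ℝ) * exp 1 - P (m + 2))| * ((a (m + 3) + 2) * D) := by ring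
  -- rewrite the target
  have hrew : |exp 1 - (p : ℝ) / q| = |(q : ℝ) * exp 1 - p| / q := by
    rw [show exp 1 - (p : ℝ) / q = ((q : ℝ) * exp 1 - p) / q by field_simp]
    rw [abs_div, abs_of_pos hq0]
  obtain ⟨hlogq, hφq0, -⟩ := loglog_div_log_bounds hq27
  have hLHS : (1 / 2 - ε) * log (log (q : ℝ)) / ((q : ℝ) ^ 2 * log (q : ℝ)) =
      ((1 / 2 - ε) * (log (log (q : ℝ)) / log (q : ℝ)) / q) / q := by
    field_simp
  rw [hrew, hLHS, div_lt_div_iff_of_pos_right hq0]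
  have step12 : (1 / 2 - ε) * (log (log (q : ℝ)) / log (q : ℝ)) / q <
      1 / ((a (m + 3) + 2) * D) := by
    have hRpos : 0 < 1 / ((a (m + 3) + 2) * D) := by positivity
    rcases le_or_gt (1 / 2 - ε) 0 with hε' | hε'
    · have : (1 / 2 - ε) * (log (log (q : ℝ)) / log (q : ℝ)) / q ≤ 0 :=
        div_nonpos_of_nonpos_of_nonneg (mul_nonpos_of_nonpos_of_nonneg hε' hφq0) hq0.le
      linarith
    · have hanti : log (log (q : ℝ)) / log (q : ℝ) ≤ log (log D) / log D :=
        loglog_div_log_anti h27 hqD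
      obtain ⟨-, hφD0, -⟩ := loglog_div_log_bounds h27
      calc (1 / 2 - ε) * (log (log (q : ℝ)) / log (q : ℝ)) / q
          ≤ (1 / 2 - ε) * (log (log D) / log D) / D := by gcongr
        _ < 1 / ((a (m + 3) + 2) * D) := by
            rw [lt_div_iff₀ (by positivity)]
            calc (1 / 2 - ε) * (log (log D) / log D) / D * ((a (m + 3) + 2) * D)
                = (1 / 2 - ε) * (log (log D) / log D) * (a (m + 3) + 2) := by
                  field_simp
              _ < 1 := hcond
  calc (1 / 2 - ε) * (log (log (q : ℝ)) / log (q : ℝ)) / q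
      < 1 / ((a (m + 3) + 2) * D) := step12
    _ ≤ |((Q (m + 2) : ℝ) * exp 1 - P (m + 2))| := step3
    _ ≤ _ := hlag

end Convergents

end Davis1978

open Real Davis1978 in
/-- **Davis 1978, Theorem 1** holds: the discharge of the named fact `Davis1978_thm1`.
The proof follows Davis (Hermite's integrals for `q_n e − p_n`, `log q_{3i} ~ i log i`,
[cite: Davis1978, Thm 1 (p. 498), Lemmas 1–3 and proof pp. 499–501]) with Cohn's packaging
of the integral identities (Cohn 2006, Amer. Math. Monthly 113, 57–62) and, in place of
Legendre's criterion plus the identification of all convergents (Davis's Lemmas 4–6),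
Lagrange's best-approximation lemma applied directly to the explicit convergents. -/
theorem Davis1978_thm1_holds : Davis1978_thm1 := by
  -- the partial quotients `a_m` (`2(m/3)` if `m % 3 = 1`, else `1`) and the convergents
  -- `p_m/q_m` of `[1; 0, 1, 1, 2, 1, 1, 4, …]`, by an anonymous recursion on pairs of
  -- consecutive terms
  let A : ℕ → ℕ := fun m => if m % 3 = 1 then 2 * (m / 3) else 1
  let Pp : ℕ → ℕ × ℕ := fun n =>
    Nat.rec ((1, 1) : ℕ × ℕ) (fun m v => (v.2, A (m + 2) * v.2 + v.1)) n
  let Qp : ℕ → ℕ × ℕ := fun n =>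
    Nat.rec ((1, 0) : ℕ × ℕ) (fun m v => (v.2, A (m + 2) * v.2 + v.1)) n
  have hA2 : ∀ i : ℕ, A (3 * i + 2) = 1 := fun i => if_neg (by omega)
  have hA3 : ∀ i : ℕ, A (3 * i + 3) = 1 := fun i => if_neg (by omega)
  have hA4 : ∀ i : ℕ, A (3 * i + 4) = 2 * i + 2 := fun i => by
    show (if (3 * i + 4) % 3 = 1 then 2 * ((3 * i + 4) / 3) else 1) = 2 * i + 2
    rw [if_pos (by omega)]; omega
  obtain ⟨a, P, Q, h⟩ : ∃ a P Q : ℕ → ℕ, (∀ i : ℕ, a (3 * i + 2) = 1) ∧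
      (∀ i : ℕ, a (3 * i + 3) = 1) ∧ (∀ i : ℕ, a (3 * i + 4) = 2 * i + 2) ∧
      P 0 = 1 ∧ P 1 = 1 ∧ (∀ m : ℕ, P (m + 2) = a (m + 2) * P (m + 1) + P m) ∧
      Q 0 = 1 ∧ Q 1 = 0 ∧ ∀ m : ℕ, Q (m + 2) = a (m + 2) * Q (m + 1) + Q m := by
    exact ⟨A, fun n => (Pp n).1, fun n => (Qp n).1, hA2, hA3, hA4, rfl, rfl, fun _ => rfl,
      rfl, rfl, fun _ => rfl⟩
  intro ε hε
  constructor
  · -- (1): infinitely many solutions, namely `q = q_{3i+3}` for all large `i`.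
    obtain ⟨i₁, hi₁⟩ : ∃ i₁ : ℕ, log 8 < 2 * ε * log ((i₁ : ℝ) + 1) := by
      set c : ℝ := log 8 / (2 * ε) with hc
      refine ⟨⌈exp c⌉₊, ?_⟩
      have h1 : exp c < (⌈exp c⌉₊ : ℝ) + 1 := by linarith [Nat.le_ceil (exp c)]
      have h2 : c < log ((⌈exp c⌉₊ : ℝ) + 1) := by
        have := log_lt_log (exp_pos c) h1
        rwa [log_exp] at this
      have h3 : log 8 = 2 * ε * c := by rw [hc]; field_simp
      rw [h3]
      exact mul_lt_mul_of_pos_left h2 (by positivity)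
    set i₀ : ℕ := max 3 i₁ with hi₀
    have hmem : ∀ j : ℕ, Q (3 * (j + i₀) + 3) ∈
        {q : ℕ | ∃ p : ℤ,
          |exp 1 - p / q| < (1 / 2 + ε) * log (log q) / ((q : ℝ) ^ 2 * log q)} := by
      intro j
      refine ⟨(P (3 * (j + i₀) + 3) : ℤ), ?_⟩
      have hj3 : 3 ≤ j + i₀ := le_trans (le_max_left _ _) (Nat.le_add_left _ _)
      have hj : log 8 < 2 * ε * log (((j + i₀ : ℕ) : ℝ) + 1) := by
        refine lt_of_lt_of_le hi₁ ?_
        apply mul_le_mul_of_nonneg_left _ (by positivity)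
        apply log_le_log (by positivity)
        have : (i₁ : ℝ) ≤ ((j + i₀ : ℕ) : ℝ) := by
          exact_mod_cast le_trans (le_max_right 3 i₁) (Nat.le_add_left _ _)
        linarith
      exact upper_estimate h hε hj3 hj
    exact Set.infinite_of_injective_forall_mem
      (f := fun j : ℕ => Q (3 * (j + i₀) + 3))
      (fun a b hab => by
        have := (den_big_strictMono h).injective hab
        omega) hmem
  · -- (2): the lower bound for all `q ≥ q'`.
    obtain ⟨m₀, hm₀⟩ := lower_threshold h hε
    refine ⟨Q (m₀ + 2), fun p q hq => ?_⟩
    -- locate `q` between consecutive denominators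
    have hex : ∃ n, q < Q (n + 1) := by
      refine ⟨3 * q + 5, ?_⟩
      have h1 : q ≤ Q (3 * q + 3) := (den_big_strictMono h).id_le q
      have h2 : Q (3 * q + 3) < Q (3 * (q + 1) + 3) :=
        den_big_strictMono h (Nat.lt_succ_self q)
      rw [show 3 * q + 5 + 1 = 3 * (q + 1) + 3 by ring]
      omega
    classical
    obtain ⟨n, hn1, hn2⟩ : ∃ n, q < Q (n + 1) ∧ ∀ k, k < n → Q (k + 1) ≤ q := by
      exact ⟨Nat.find hex, Nat.find_spec hex, fun k hk => not_lt.mp (Nat.find_min hex hk)⟩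
    have hnm : m₀ + 2 ≤ n := by
      by_contra hcon
      push Not at hcon
      have : Q (n + 1) ≤ Q (m₀ + 2) := den_mono h (by omega) (by omega)
      omega
    obtain ⟨m, rfl⟩ : ∃ m, n = m + 2 := ⟨n - 2, by omega⟩
    have hqm : Q (m + 2) ≤ q := hn2 (m + 1) (by omega)
    obtain ⟨h27, hcond⟩ := hm₀ m (by omega)
    exact lower_estimate h m h27 hcond hqm hn1

end Literature.NumberTheory.DiophantineApproximation
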